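import Summits.QuantumFields.BalabanUV.Beta.EriceFlowEnclosureB12AsPrintedPointwiseFadingZeroHistoryConstantsEnd

/-!
# Beta / EriceFlowEnclosureB12AsPrintedPointwiseFadingZeroHistoryConstantsStability — WHAT (0.31) FORCES, part 14c: STABILITY.
# The zero-history values and the asymptotic constant are LIPSCHITZ functionals of the family in the sup-norm on small boxes, and `b⋆` is a UV-GERM INVARIANT; consequently
# **THE g-UNIFORM (0.31) IS AN OPEN CONDITION, WITH MARGIN THE FLOOR `⨅_k b⁰_k`** (part 14b: the uniform (0.31) ⟺ a positive floor):
#  §1 `abs_zeroHist_sub_zeroHist_le`: two families with moduli that are `η`-close on SOME box ]0, δ]^{k+1} have `|b⁰_k − b⁰′_k| ≤ η` (`zeroHist_eq_of_agree`: equal if they agree near the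
#     zero corner at scale k — `b⁰_k` depends on the GERM of `β_{k+1}` at the zero history only); `floor_of_near`: a floor `b` on `b⁰` passes to an `η`-close family as `b − η`.
#  §2 `abs_bstar_sub_bstar_le`: under NE4 for both, `η`-closeness on the boxes ]0, δ]^{k+1} for all LATE scales `k ≥ k₁` gives `|b⋆ − b⋆′| ≤ η`; **`bstar_eq_of_eventually_agree`**: two families
#     agreeing near the zero corner from some scale on have THE SAME asymptotic constant — `b⋆` ignores every finite set of scales and every coupling away from zero (the typed Theorem 2's
#     sign bit `0 < b⋆`, part 11d, is a property of the deep-ultraviolet germ; the CAP list, part 14b §2, is where the early scales enter).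
#  §3 ON THE CARRIER: **`uniformTheorem2_of_near_floor`** — a setting (printed `Definitions`, (C), (U), moduli) whose β is `η`-close near zero to ANY reference family with a floor `b > η`
#     on its zero-history values carries the g-uniform (0.31) and Theorem 2 AS TYPED; **`uniformTheorem2_isOpen`** — if a setting carries `hTu` (+ `hrg` + moduli), there is a MARGIN `μ > 0`
#     (Theorem 2's own `β ln L`) such that EVERY admissible setting whose β-functions are `η`-close to it near zero, `η < μ`, carries `hTu` too.  The TYPED reading is NOT open: part 14d
#     (`…ZeroHistoryConstantsWitness`) tilts part 8a's ramp by `−ε g₁` — arbitrarily close, same `b⁰`, same `b⋆`, all letters — and Theorem 2 as typed FAILS for every setting carrying it.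
# (β-flow team, prover 2 = lower ∕ positivity side, unit `b2b-balaban-beta-bflow-p2`, gen 52; ROW AP-I × node U2's letters; part 14c)

HONEST FRAMING (page 1 of everything the β sub-cell writes): discharging `BetaPertH` makes Bałaban's UV stability UNCONDITIONAL — a
real constructive-QFT result; it is NOT the continuum limit and NOT the Clay problem.  HONEST DEPENDENCY (cell reorg 2026-08-19,
verbatim): «continuum YM on T⁴ ⇐ BetaPertH ∧ nine spine estimates (0/9 proved); BetaPertH ⇐ (D1) ∧ (D4) ∧ CAP+tail; G-an2-4 gates
asym, D1 and NE2/3/4.»  THIS MODULE DISCHARGES NOTHING: [folklore] limit bookkeeping for ABSTRACT families `β, β′ : FlowStep.HBeta` under node U2's HYPOTHESIS SHAPES (NONE printed;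
GAPS G-t4-U2-1 ∕ 2), over part 13's `exists_small_const` ∕ `exists_zeroHist` ∕ `tendsto_zeroHist_bstar` and part 14 ∕ 14b BY NAME; on the carrier the statement-exact typing `B12BetaAsPrinted`
(`Definitions`; `Theorem2Statement` a HYPOTHESIS shape), prover 1's binder `hrg`, the letters (C) ∕ (U) and ONE READING `hTu`.  "Close", "margin", "germ" are this file's words for
displayed inequalities; nothing of Bałaban's (1.22) — in particular no closeness of it to any model family — is asserted.

WHAT THIS FILE PROVES (0 sorry, 0 def):
§1 **`abs_zeroHist_sub_zeroHist_le`**, `zeroHist_eq_of_agree`, `floor_of_near`.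
§2 **`abs_bstar_sub_bstar_le`**, **`bstar_eq_of_eventually_agree`**.
§3 **`uniformTheorem2_of_near_floor`**, **`uniformTheorem2_isOpen`**.
NOT CLAIMED: any closeness of Bałaban's β to anything; which reading print intends; Theorem 2; `BetaPertH`; continuum; Clay.
-/

namespace Summit.QuantumFields.BalabanUV.Beta.EriceFlowEnclosureB12AsPrintedPointwiseFadingZeroHistoryConstantsStability

open Finset Filter Topology
open Literature.MathematicalPhysics.QuantumFieldTheory.Balaban1983to89
open Literature.MathematicalPhysics.QuantumFieldTheory.Balaban1983to89.B12BetaAsPrinted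
open Literature.MathematicalPhysics.QuantumFieldTheory.Balaban1983to89.FlowStep (HBeta prefixOf Box mem_box box_mono RGEqH BetaLowerH BetaUpperH
  BetaAFH BetaContH)
open Literature.MathematicalPhysics.QuantumFieldTheory.Balaban1983to89.T4CouplingMatching (HistLipschitz FadingMemory ScaleShiftRate)
open Literature.MathematicalPhysics.QuantumFieldTheory.Balaban1983to89.T4BetaStationary (betaInf constant_nonneg_of_scaleShiftRate)
open Summit.QuantumFields.BalabanUV.Beta.EriceFlowEnclosureB12AsPrintedPointwiseFadingZeroHistory
open Summit.QuantumFields.BalabanUV.Beta.EriceFlowEnclosureB12AsPrintedPointwiseFadingZeroHistoryConstants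
open Summit.QuantumFields.BalabanUV.Beta.EriceFlowEnclosureB12AsPrintedPointwiseFadingZeroHistoryConstantsEnd

noncomputable section

/-! ## §1 The zero-history values are 1-Lipschitz in the family, scale by scale, and see only the germ at the zero corner -/

section Generic

variable {β β' : HBeta} {γ γ' C C' c c' θ θ' : ℝ}

/-- **`b⁰_k` IS 1-LIPSCHITZ IN THE FAMILY.**  If `b⁰`, `b⁰′` are zero-history values of `β`, `β′` (displayed properties on ]0, γ] resp. ]0, γ′], any constants) and on SOME box ]0, δ]^{k+1}
`|β_{k+1}(v) − β′_{k+1}(v)| ≤ η`, then `|b⁰_k − b⁰′_k| ≤ η` (compare along the constant histories `(u,…,u)`, `u → 0⁺`). [folklore] -/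
theorem abs_zeroHist_sub_zeroHist_le (hθ1 : θ < 1) (hC : 0 ≤ C) (hγ : 0 < γ) (hθ1' : θ' < 1) (hC' : 0 ≤ C') (hγ' : 0 < γ')
    {b0 b0' : ℕ → ℝ}
    (hb0 : ∀ (k : ℕ) (u : ℝ), 0 < u → u ≤ γ → |β k (fun _ : Fin (k + 1) => u) - b0 k| ≤ C * u / (1 - θ))
    (hb0' : ∀ (k : ℕ) (u : ℝ), 0 < u → u ≤ γ' → |β' k (fun _ : Fin (k + 1) => u) - b0' k| ≤ C' * u / (1 - θ'))
    {k : ℕ} {δ η : ℝ} (hδ : 0 < δ) (hclose : ∀ v : Fin (k + 1) → ℝ, v ∈ Box δ k → |β k v - β' k v| ≤ η) :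
    |b0 k - b0' k| ≤ η := by
  have h1θ : 0 < 1 - θ := by linarith
  have h1θ' : 0 < 1 - θ' := by linarith
  have hK : 0 ≤ C / (1 - θ) + C' / (1 - θ') := add_nonneg (div_nonneg hC h1θ.le) (div_nonneg hC' h1θ'.le)
  refine le_of_forall_pos_le_add fun ε hε => ?_
  obtain ⟨u, hu, huγ, hsmall⟩ := exists_small_const (lt_min (lt_min hγ hγ') hδ) hK (by norm_num : (0 : ℝ) < 1) hε
  have huγ1 : u ≤ γ := (huγ.trans (min_le_left _ _)).trans (min_le_left _ _)
  have huγ2 : u ≤ γ' := (huγ.trans (min_le_left _ _)).trans (min_le_right _ _)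
  have huδ : u ≤ δ := huγ.trans (min_le_right _ _)
  have h1 := hb0 k u hu huγ1
  have h2 := hb0' k u hu huγ2
  have h3 := hclose (fun _ : Fin (k + 1) => u) (mem_box.mpr fun _ => ⟨hu, huδ⟩)
  have htri : |b0 k - b0' k| ≤ |β k (fun _ : Fin (k + 1) => u) - b0 k| + |β k (fun _ : Fin (k + 1) => u) - β' k (fun _ : Fin (k + 1) => u)| +
      |β' k (fun _ : Fin (k + 1) => u) - b0' k| := by
    have e : b0 k - b0' k = -(β k (fun _ : Fin (k + 1) => u) - b0 k) + (β k (fun _ : Fin (k + 1) => u) - β' k (fun _ : Fin (k + 1) => u)) +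
        (β' k (fun _ : Fin (k + 1) => u) - b0' k) := by ring
    rw [e]
    refine (abs_add_le _ _).trans (add_le_add ((abs_add_le _ _).trans (add_le_add (le_of_eq (abs_neg _)) le_rfl)) le_rfl)
  have e1 : C * u / (1 - θ) + C' * u / (1 - θ') = (C / (1 - θ) + C' / (1 - θ')) * u := by ring
  have e2 : 2 * (C / (1 - θ) + C' / (1 - θ')) * u / (1 - 0) = 2 * ((C / (1 - θ) + C' / (1 - θ')) * u) := by ring
  nlinarith [htri, h1, h2, h3, hsmall, e1, e2, mul_nonneg hK hu.le]

/-- **`b⁰_k` SEES ONLY THE GERM AT THE ZERO CORNER**: two families agreeing on some box ]0, δ]^{k+1} have the same k-th zero-history value. [folklore] -/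
theorem zeroHist_eq_of_agree (hθ1 : θ < 1) (hC : 0 ≤ C) (hγ : 0 < γ) (hθ1' : θ' < 1) (hC' : 0 ≤ C') (hγ' : 0 < γ') {b0 b0' : ℕ → ℝ}
    (hb0 : ∀ (k : ℕ) (u : ℝ), 0 < u → u ≤ γ → |β k (fun _ : Fin (k + 1) => u) - b0 k| ≤ C * u / (1 - θ))
    (hb0' : ∀ (k : ℕ) (u : ℝ), 0 < u → u ≤ γ' → |β' k (fun _ : Fin (k + 1) => u) - b0' k| ≤ C' * u / (1 - θ'))
    {k : ℕ} {δ : ℝ} (hδ : 0 < δ) (hagree : ∀ v : Fin (k + 1) → ℝ, v ∈ Box δ k → β k v = β' k v) : b0 k = b0' k := by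
  have h := abs_zeroHist_sub_zeroHist_le hθ1 hC hγ hθ1' hC' hγ' hb0 hb0' hδ (η := 0) fun v hv => by rw [hagree v hv, sub_self, abs_zero]
  exact sub_eq_zero.mp (abs_nonpos_iff.mp h)

/-- **A FLOOR PASSES TO NEARBY FAMILIES**: `(∀k, b ≤ b⁰_k)` for β and `η`-closeness on the boxes ]0, δ]^{k+1} at every scale ⟹ `(∀k, b − η ≤ b⁰′_k)` for β′. [folklore] -/
theorem floor_of_near (hθ1 : θ < 1) (hC : 0 ≤ C) (hγ : 0 < γ) (hθ1' : θ' < 1) (hC' : 0 ≤ C') (hγ' : 0 < γ') {b0 b0' : ℕ → ℝ}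
    (hb0 : ∀ (k : ℕ) (u : ℝ), 0 < u → u ≤ γ → |β k (fun _ : Fin (k + 1) => u) - b0 k| ≤ C * u / (1 - θ))
    (hb0' : ∀ (k : ℕ) (u : ℝ), 0 < u → u ≤ γ' → |β' k (fun _ : Fin (k + 1) => u) - b0' k| ≤ C' * u / (1 - θ'))
    {δ η b : ℝ} (hδ : 0 < δ) (hclose : ∀ (k : ℕ) (v : Fin (k + 1) → ℝ), v ∈ Box δ k → |β k v - β' k v| ≤ η)
    (hfloor : ∀ k, b ≤ b0 k) (k : ℕ) : b - η ≤ b0' k := by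
  have h := (abs_le.mp (abs_zeroHist_sub_zeroHist_le hθ1 hC hγ hθ1' hC' hγ' hb0 hb0' hδ (hclose k))).2
  linarith [hfloor k]

/-! ## §2 The asymptotic constant is η-stable under late closeness: `b⋆` is a UV-germ invariant -/

/-- **`b⋆` IS 1-LIPSCHITZ IN THE LATE GERM.**  Both families carry node U2's letters (moduli + NE4, own constants) with zero-history values `b⁰`, `b⁰′` and asymptotic constants `b⋆`, `b⋆′`
(part 11's `hb`); if `|β_{k+1} − β′_{k+1}| ≤ η` on the boxes ]0, δ]^{k+1} for all `k ≥ k₁`, then **`|b⋆ − b⋆′| ≤ η`** (`b⁰_k → b⋆`, `b⁰′_k → b⋆′`, §1 at the late scales). [folklore] -/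
theorem abs_bstar_sub_bstar_le (hS : ScaleShiftRate c θ γ β) (hθ0 : 0 ≤ θ) (hθ1 : θ < 1) (hC : 0 ≤ C) (hγ : 0 < γ)
    (hS' : ScaleShiftRate c' θ' γ' β') (hθ0' : 0 ≤ θ') (hθ1' : θ' < 1) (hC' : 0 ≤ C') (hγ' : 0 < γ') {b0 b0' : ℕ → ℝ}
    (hb0 : ∀ (k : ℕ) (u : ℝ), 0 < u → u ≤ γ → |β k (fun _ : Fin (k + 1) => u) - b0 k| ≤ C * u / (1 - θ))
    (hb0' : ∀ (k : ℕ) (u : ℝ), 0 < u → u ≤ γ' → |β' k (fun _ : Fin (k + 1) => u) - b0' k| ≤ C' * u / (1 - θ')) {bstar bstar' : ℝ}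
    (hb : ∀ u : ℝ, 0 < u → u ≤ γ → |betaInf β (fun _ : ℕ => u) - bstar| ≤ C * u / (1 - θ))
    (hb' : ∀ u : ℝ, 0 < u → u ≤ γ' → |betaInf β' (fun _ : ℕ => u) - bstar'| ≤ C' * u / (1 - θ'))
    {δ η : ℝ} {k₁ : ℕ} (hδ : 0 < δ) (hclose : ∀ k, k₁ ≤ k → ∀ v : Fin (k + 1) → ℝ, v ∈ Box δ k → |β k v - β' k v| ≤ η) :
    |bstar - bstar'| ≤ η := by
  have ht : Tendsto (fun k => |b0 k - b0' k|) atTop (𝓝 |bstar - bstar'|) :=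
    ((tendsto_zeroHist_bstar hS hθ0 hθ1 hC hγ hb0 hb).sub (tendsto_zeroHist_bstar hS' hθ0' hθ1' hC' hγ' hb0' hb')).abs
  refine le_of_tendsto ht (Filter.eventually_atTop.2 ⟨k₁, fun k hk => ?_⟩)
  exact abs_zeroHist_sub_zeroHist_le hθ1 hC hγ hθ1' hC' hγ' hb0 hb0' hδ (hclose k hk)

/-- **`b⋆` IS A UV-GERM INVARIANT.**  Two families with node U2's letters that AGREE on the boxes ]0, δ]^{k+1} for all `k ≥ k₁` (some δ > 0, some k₁) have the same asymptotic constant: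
the early scales `k < k₁` and the couplings above δ are invisible to `b⋆` — hence to the sign bit the typed Theorem 2 delivers (part 11d `bstar_pos_of_typedTheorem2`); the early scales
re-enter only through the CAP list (part 14b `capList_of_typedTheorem2`). [folklore] -/
theorem bstar_eq_of_eventually_agree {Λ Λ' : ℕ → ℕ → ℝ} (hL : HistLipschitz Λ γ β) (hΛ : FadingMemory C θ Λ) (hS : ScaleShiftRate c θ γ β)
    (hθ0 : 0 ≤ θ) (hθ1 : θ < 1) (hC : 0 ≤ C) (hγ : 0 < γ) (hL' : HistLipschitz Λ' γ' β') (hΛ' : FadingMemory C' θ' Λ')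
    (hS' : ScaleShiftRate c' θ' γ' β') (hθ0' : 0 ≤ θ') (hθ1' : θ' < 1) (hC' : 0 ≤ C') (hγ' : 0 < γ') {bstar bstar' : ℝ}
    (hb : ∀ u : ℝ, 0 < u → u ≤ γ → |betaInf β (fun _ : ℕ => u) - bstar| ≤ C * u / (1 - θ))
    (hb' : ∀ u : ℝ, 0 < u → u ≤ γ' → |betaInf β' (fun _ : ℕ => u) - bstar'| ≤ C' * u / (1 - θ'))
    {δ : ℝ} {k₁ : ℕ} (hδ : 0 < δ) (hagree : ∀ k, k₁ ≤ k → ∀ v : Fin (k + 1) → ℝ, v ∈ Box δ k → β k v = β' k v) : bstar = bstar' := by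
  obtain ⟨b0, hb0⟩ := exists_zeroHist hL hΛ hθ0 hθ1 hC hγ
  obtain ⟨b0', hb0'⟩ := exists_zeroHist hL' hΛ' hθ0' hθ1' hC' hγ'
  have h := abs_bstar_sub_bstar_le hS hθ0 hθ1 hC hγ hS' hθ0' hθ1' hC' hγ' hb0 hb0' hb hb' hδ (η := 0)
    fun k hk v hv => by rw [hagree k hk v hv, sub_self, abs_zero]
  exact sub_eq_zero.mp (abs_nonpos_iff.mp h)

end Generic

/-! ## §3 On the carrier: the g-uniform (0.31) is an open condition with margin the floor -/

section Carrier

variable {S : Setting}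

/-- **NEAR A FAMILY WITH A FLOOR, THE g-UNIFORM (0.31) HOLDS.**  A setting with the printed `Definitions`, (C), (U) and node U2's moduli on ]0, γ_U], whose β-functions are `η`-close on the
boxes ]0, δ]^{k+1} (every k) to ANY reference family `βref` with zero-history values `bref` (displayed property, own constants) floored by `b > η`, carries `hTu` and Theorem 2 AS TYPED: its
own zero-history values are floored by `b − η > 0` (§1) and part 14b's `uniformTheorem2_of_pos_floor` applies.  The reference family need not carry NE4, (C), (U) or belong to a setting.
[cite: Balaban1987RG1, Thm 2 (0.31) p.259 with (2.12) p.268 and p.298] -/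
theorem uniformTheorem2_of_near_floor (hDef : Definitions S) (hL : Odd S.L ∧ 1 < S.L) {γU C θ b' : ℝ} {Λ : ℕ → ℕ → ℝ}
    (hγU : 0 < γU) (hθ0 : 0 ≤ θ) (hθ1 : θ < 1) (hC : 0 ≤ C)
    (hLip : HistLipschitz Λ γU S.β) (hΛ : FadingMemory C θ Λ) (hcont : BetaContH γU S.β) (hup : BetaUpperH b' γU S.β)
    {βref : HBeta} {γr Cr θr : ℝ} (hθr : θr < 1) (hCr : 0 ≤ Cr) (hγr : 0 < γr) {bref : ℕ → ℝ}
    (hbref : ∀ (k : ℕ) (u : ℝ), 0 < u → u ≤ γr → |βref k (fun _ : Fin (k + 1) => u) - bref k| ≤ Cr * u / (1 - θr))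
    {b δ η : ℝ} (hfloor : ∀ k, b ≤ bref k) (hδ : 0 < δ) (hηb : η < b)
    (hclose : ∀ (k : ℕ) (v : Fin (k + 1) → ℝ), v ∈ Box δ k → |βref k v - S.β k v| ≤ η) :
    (∀ m : ℕ, ∃ γ₁ : ℝ, 0 < γ₁ ∧ ∀ γ : ℝ, 0 < γ → γ ≤ γ₁ → ∃ g₁ : ℝ, 0 < g₁ ∧ ∃ β β' : ℝ, 0 < β ∧ β ≤ β' ∧
      ∀ g : ℝ, 0 < g → g ≤ g₁ → ∀ K : ℕ, ∃ g₀ : ℝ, Step.InInterval γ K (S.cpl ⟨K, m, g₀⟩) ∧ S.cpl ⟨K, m, g₀⟩ K = g ∧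
        Step.Discrete031 (β * Real.log S.L) (β' * Real.log S.L) K g (S.cpl ⟨K, m, g₀⟩)) ∧ Theorem2Statement S hL := by
  obtain ⟨b0, hb0⟩ := exists_zeroHist hLip hΛ hθ0 hθ1 hC hγU
  exact uniformTheorem2_of_pos_floor hDef hL hγU hθ0 hθ1 hC hLip hΛ hcont hup hb0
    ⟨b - η, by linarith, floor_of_near hθr hCr hγr hθ1 hC hγU hbref hb0 hδ hclose hfloor⟩

/-- **THE g-UNIFORM (0.31) IS AN OPEN CONDITION.**  If a setting `S` carries `hTu`, prover 1's `hrg` and node U2's moduli on ]0, γ_U], then there is a MARGIN `μ > 0` (Theorem 2's own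
`β ln L`, a floor on `S`'s zero-history values by part 14b §1) such that EVERY setting `S′` with the printed `Definitions`, 1 < L′, moduli, (C), (U) on its box ]0, γ_U′], whose
β-functions are `η`-close to `S`'s on the boxes ]0, δ]^{k+1} (every k) with `η < μ`, carries the g-uniform (0.31) as well.  The typed reading has no such margin (part 14d). [cite: Balaban1987RG1, Thm 2 (0.31) p.259 with p.298] -/
theorem uniformTheorem2_isOpen
    (hTu : ∀ m : ℕ, ∃ γ₀ : ℝ, 0 < γ₀ ∧ ∀ γ : ℝ, 0 < γ → γ ≤ γ₀ → ∃ g₁ : ℝ, 0 < g₁ ∧ ∃ β β' : ℝ, 0 < β ∧ β ≤ β' ∧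
      ∀ g : ℝ, 0 < g → g ≤ g₁ → ∀ K : ℕ, ∃ g₀ : ℝ, Step.InInterval γ K (S.cpl ⟨K, m, g₀⟩) ∧ S.cpl ⟨K, m, g₀⟩ K = g ∧
        Step.Discrete031 (β * Real.log S.L) (β' * Real.log S.L) K g (S.cpl ⟨K, m, g₀⟩))
    (hL1 : 1 < S.L) {γU C θ : ℝ} {Λ : ℕ → ℕ → ℝ} (hγU : 0 < γU) (hθ0 : 0 ≤ θ) (hθ1 : θ < 1) (hC : 0 ≤ C)
    (hrg : ∀ P : B12.RunParams, Step.InInterval γU P.K (S.cpl P) → RGEqH P.K S.β (S.cpl P))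
    (hLip : HistLipschitz Λ γU S.β) (hΛ : FadingMemory C θ Λ) :
    ∃ μ : ℝ, 0 < μ ∧ ∀ (S' : Setting) (hL' : Odd S'.L ∧ 1 < S'.L) (γU' C' θ' b'' δ η : ℝ) (Λ' : ℕ → ℕ → ℝ),
      Definitions S' → 0 < γU' → 0 ≤ θ' → θ' < 1 → 0 ≤ C' → HistLipschitz Λ' γU' S'.β → FadingMemory C' θ' Λ' →
      BetaContH γU' S'.β → BetaUpperH b'' γU' S'.β → 0 < δ → η < μ →
      (∀ (k : ℕ) (v : Fin (k + 1) → ℝ), v ∈ Box δ k → |S.β k v - S'.β k v| ≤ η) →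
      (∀ m : ℕ, ∃ γ₁ : ℝ, 0 < γ₁ ∧ ∀ γ : ℝ, 0 < γ → γ ≤ γ₁ → ∃ g₁ : ℝ, 0 < g₁ ∧ ∃ β β' : ℝ, 0 < β ∧ β ≤ β' ∧
        ∀ g : ℝ, 0 < g → g ≤ g₁ → ∀ K : ℕ, ∃ g₀ : ℝ, Step.InInterval γ K (S'.cpl ⟨K, m, g₀⟩) ∧ S'.cpl ⟨K, m, g₀⟩ K = g ∧
          Step.Discrete031 (β * Real.log S'.L) (β' * Real.log S'.L) K g (S'.cpl ⟨K, m, g₀⟩)) ∧ Theorem2Statement S' hL' := by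
  have hlog : 0 < Real.log (S.L : ℝ) := Real.log_pos (by exact_mod_cast hL1)
  obtain ⟨b0, hb0⟩ := exists_zeroHist hLip hΛ hθ0 hθ1 hC hγU
  obtain ⟨β, β', hβ, -, hwin⟩ := zeroHist_window_of_uniformTheorem2 hTu 0 hL1 hγU hθ0 hθ1 hC hrg hLip hΛ hb0
  refine ⟨β * Real.log S.L, mul_pos hβ hlog, ?_⟩
  intro S' hL' γU' C' θ' b'' δ η Λ' hDef' hγU' hθ0' hθ1' hC' hLip' hΛ' hcont' hup' hδ hη hclose
  exact uniformTheorem2_of_near_floor hDef' hL' hγU' hθ0' hθ1' hC' hLip' hΛ' hcont' hup' hθ1 hC hγU hb0 (fun k => (hwin k).1) hδ hη hclose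

end Carrier

end

end Summit.QuantumFields.BalabanUV.Beta.EriceFlowEnclosureB12AsPrintedPointwiseFadingZeroHistoryConstantsStability
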